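import Mathlib.NumberTheory.Harmonic.Bounds
import Summits.QuantumFields.BalabanUV.Beta.EriceFlowEnclosureCesaroClockSampling
import Summits.QuantumFields.BalabanUV.Beta.EriceFlowEnclosureCesaroHarmonicAtTop

/-!
# Beta / EriceFlowEnclosureCesaroClockHarmonic — THE CUTOFF SUM IS THE HARMONIC INTEGRAL (service for «the discrete and the continuous
# RG-time averages agree», P2 #53j): for M C-log-Lipschitz and continuous on ]0, δ[ and L₀ > 0, the ideal samples `M(L₀∕n)` satisfy
#     **`|Σ_{n₀ ≤ n < N} M(L₀∕n) − L₀·∫_{L₀∕N}^{L₀∕n₀} M(s) s⁻² ds| ≤ C·(1 + log N)`**   (n₀ ≥ 1, L₀∕n₀ < δ)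
# — a harmonic sum of cell errors `C·log((n+1)∕n) ≤ C∕n` plus the substitution `s = L₀∕y` (row L129's `integral_comp_inv_eq`); and the boundary
# estimate `|∫ₐᵇ M s⁻²| ≤ B·|a⁻¹ − b⁻¹|` for |M| ≤ B.  Row L127's harmonic scale average is `H_c(t) = t·∫ₜᶜ M s⁻²`; with t = h_N ≈ L₀∕N the
# right-hand side above is `≈ N·H_c(h_N)`, which P2 #53j turns into `N⁻¹Σ_{n<N} M(h_n) − H_c(h_N) → 0` along any clock sequence.
# (β-flow team, prover 2 = lower ∕ positivity side, unit `b2b-balaban-beta-bflow-p2`, gen 36; module P2 #53i; pure [folklore]; no Erice sentence)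

HONEST FRAMING (page 1 of everything the β sub-cell writes): discharging `BetaPertH` makes Bałaban's UV stability UNCONDITIONAL — a
real constructive-QFT result; it is NOT the continuum limit and NOT the Clay problem.  HONEST DEPENDENCY (cell reorg 2026-08-19,
verbatim): «continuum YM on T⁴ ⇐ BetaPertH ∧ nine spine estimates (0/9 proved); BetaPertH ⇐ (D1) ∧ (D4) ∧ CAP+tail; G-an2-4 gates
asym, D1 and NE2/3/4.»  THIS MODULE DISCHARGES NOTHING and quotes nothing: [folklore] real analysis about a real function M (shape: the
three-loop Cesàro mean, bounded and 2C₂-log-Lipschitz by P2 #52a) — a sum-versus-integral estimate and a change of variables.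

WHAT THIS FILE PROVES (0 sorry, 0 def): §1 `comp_logLip`, `comp_continuousOn`, `cell_le`, `sum_Ico_inv_le'`, HEADLINE **`sum_integral_le`**;
§2 `integral_comp_div_eq` (`∫ₐᵇ M(L₀∕y) dy = L₀·∫_{L₀∕b}^{L₀∕a} M(s) s⁻² ds`), **`sum_harmonic_le`** (the displayed inequality); §3 `integral_div_sq_abs_le`.
NOT CLAIMED: the limit statement along a clock sequence (P2 #53j); anything about β; `BetaPertH`; continuum; Clay.
-/

namespace Summit.QuantumFields.BalabanUV.Beta.EriceFlowEnclosureCesaroClockHarmonic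

open Set Filter Topology Finset MeasureTheory intervalIntegral
open Summit.QuantumFields.BalabanUV.Beta.EriceFlowEnclosureCesaroClockSampling (logLip_abs)
open Summit.QuantumFields.BalabanUV.Beta.EriceFlowEnclosureCesaroHarmonicAtTop (integral_comp_inv_eq)
open Summit.QuantumFields.BalabanUV.Beta.EriceFlowEnclosureCesaroHarmonicAverage (inv_sq_integral)

noncomputable section

variable {M : ℝ → ℝ} {δ C L₀ : ℝ}

/-! ## §1 The ideal samples `M(L₀∕n)`: log-Lipschitz in n, cells, and the harmonic sum of cell errors -/

/-- `y ↦ M(L₀∕y)` is C-log-Lipschitz on ]L₀∕δ, ∞[: `|M(L₀∕y) − M(L₀∕y′)| ≤ C·log(y∕y′)` for `L₀∕δ < y′ ≤ y`. [folklore] -/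
theorem comp_logLip (hδ : 0 < δ) (hL₀ : 0 < L₀)
    (hlip : ∀ t u : ℝ, 0 < t → t ≤ u → u < δ → |M u - M t| ≤ C * Real.log (u / t))
    {y y' : ℝ} (hy' : L₀ / δ < y') (hyy : y' ≤ y) :
    |M (L₀ / y) - M (L₀ / y')| ≤ C * Real.log (y / y') := by
  have hy'0 : 0 < y' := lt_trans (div_pos hL₀ hδ) hy'
  have hy0 : 0 < y := lt_of_lt_of_le hy'0 hyy
  have h1 : L₀ / y' < δ := by rw [div_lt_iff₀ hy'0]; rw [div_lt_iff₀ hδ] at hy'; linarith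
  have h2 : L₀ / y ≤ L₀ / y' := div_le_div_of_nonneg_left hL₀.le hy'0 hyy
  have h := hlip (L₀ / y) (L₀ / y') (div_pos hL₀ hy0) h2 h1
  have hq : L₀ / y' / (L₀ / y) = y / y' := by field_simp
  rw [hq] at h
  rwa [abs_sub_comm] at h

/-- `y ↦ M(L₀∕y)` is continuous on ]L₀∕δ, ∞[ when M is continuous on ]0, δ[. [folklore] -/
theorem comp_continuousOn (hδ : 0 < δ) (hL₀ : 0 < L₀) (hcont : ContinuousOn M (Ioo 0 δ)) :
    ContinuousOn (fun y => M (L₀ / y)) (Ioi (L₀ / δ)) := by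
  refine hcont.comp (continuousOn_const.div continuousOn_id fun y hy => ?_) fun y hy => ?_
  · exact (lt_trans (div_pos hL₀ hδ) hy).ne'
  · have hy0 : 0 < y := lt_trans (div_pos hL₀ hδ) hy
    refine ⟨div_pos hL₀ hy0, ?_⟩
    rw [div_lt_iff₀ hy0]; have := hy; rw [Set.mem_Ioi, div_lt_iff₀ hδ] at this; linarith

/-- THE CELL: for an integer `n > L₀∕δ`, n ≥ 1: `|M(L₀∕n) − ∫ₙ^{n+1} M(L₀∕y) dy| ≤ C∕n` (every value on the cell is within `C·log((n+1)∕n) ≤ C∕n`).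
[folklore] -/
theorem cell_le (hδ : 0 < δ) (hL₀ : 0 < L₀) (hC : 0 ≤ C) (hcont : ContinuousOn M (Ioo 0 δ))
    (hlip : ∀ t u : ℝ, 0 < t → t ≤ u → u < δ → |M u - M t| ≤ C * Real.log (u / t))
    {n : ℕ} (hn : 1 ≤ n) (hnδ : L₀ / δ < n) :
    |M (L₀ / n) - ∫ y in (n:ℝ)..(n:ℝ) + 1, M (L₀ / y)| ≤ C / n := by
  have hn0 : (0:ℝ) < n := by exact_mod_cast (lt_of_lt_of_le Nat.one_pos hn)
  have hint : IntervalIntegrable (fun y => M (L₀ / y)) volume (n:ℝ) ((n:ℝ) + 1) :=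
    ((comp_continuousOn hδ hL₀ hcont).mono fun y hy => by
      rw [uIcc_of_le (by linarith : (n:ℝ) ≤ n + 1)] at hy; exact lt_of_lt_of_le hnδ hy.1).intervalIntegrable
  have hconst : (∫ _y in (n:ℝ)..(n:ℝ) + 1, M (L₀ / n)) = M (L₀ / n) := by
    rw [intervalIntegral.integral_const]; simp
  rw [← hconst, ← intervalIntegral.integral_sub intervalIntegrable_const hint]
  have hbound : ∀ y ∈ Set.uIoc (n:ℝ) ((n:ℝ) + 1), ‖M (L₀ / n) - M (L₀ / y)‖ ≤ C / n := by
    intro y hy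
    rw [uIoc_of_le (by linarith : (n:ℝ) ≤ n + 1)] at hy
    rw [Real.norm_eq_abs, abs_sub_comm]
    calc _ ≤ C * Real.log (y / n) := comp_logLip hδ hL₀ hlip hnδ hy.1.le
      _ ≤ C * (y / n - 1) := mul_le_mul_of_nonneg_left (Real.log_le_sub_one_of_pos (div_pos (by linarith [hy.1]) hn0)) hC
      _ ≤ C * (1 / n) := by
          apply mul_le_mul_of_nonneg_left _ hC
          rw [div_sub_one hn0.ne']; exact div_le_div_of_nonneg_right (by linarith [hy.2]) hn0.le
      _ = C / n := by ring
  have h := intervalIntegral.norm_integral_le_of_norm_le_const hbound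
  rw [Real.norm_eq_abs] at h
  simpa using h

/-- `Σ_{n₀ ≤ n < N} 1∕n ≤ 1 + log N` for `1 ≤ n₀ ≤ N` (Mathlib's `harmonic_le_one_add_log`). [folklore] -/
theorem sum_Ico_inv_le' {n₀ N : ℕ} (hn₀ : 1 ≤ n₀) (hN : n₀ ≤ N) :
    ∑ n ∈ Finset.Ico n₀ N, ((n : ℝ))⁻¹ ≤ 1 + Real.log N := by
  have h1 : ∑ n ∈ Finset.Ico n₀ N, ((n : ℝ))⁻¹ ≤ ∑ n ∈ Finset.Ico 1 N, ((n : ℝ))⁻¹ :=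
    sum_le_sum_of_subset_of_nonneg (Finset.Ico_subset_Ico hn₀ le_rfl) fun n _ _ => inv_nonneg.mpr (Nat.cast_nonneg n)
  have h2 : ∑ n ∈ Finset.Ico 1 N, ((n : ℝ))⁻¹ = (harmonic (N - 1) : ℝ) := by
    rw [sum_Ico_eq_sum_range]
    simp only [harmonic, Rat.cast_sum, Rat.cast_inv, Rat.cast_natCast]
    refine sum_congr rfl fun k _ => ?_
    push_cast; ring
  have h3 : (harmonic (N - 1) : ℝ) ≤ 1 + Real.log ((N - 1 : ℕ) : ℝ) := harmonic_le_one_add_log (N - 1)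
  have h4 : Real.log ((N - 1 : ℕ) : ℝ) ≤ Real.log N := by
    rcases Nat.eq_zero_or_pos (N - 1) with h0 | hpos
    · rw [h0, Nat.cast_zero, Real.log_zero]; exact Real.log_nonneg (by exact_mod_cast (hn₀.trans hN))
    · exact Real.log_le_log (by exact_mod_cast hpos) (by exact_mod_cast Nat.sub_le N 1)
  linarith

/-- **THE SUM IS THE INTEGRAL UP TO A HARMONIC SUM (HEADLINE)**: for `1 ≤ n₀ ≤ N` with `L₀∕δ < n₀`:
**`|Σ_{n₀ ≤ n < N} M(L₀∕n) − ∫_{n₀}^{N} M(L₀∕y) dy| ≤ C·(1 + log N)`**. [folklore] -/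
theorem sum_integral_le (hδ : 0 < δ) (hL₀ : 0 < L₀) (hC : 0 ≤ C) (hcont : ContinuousOn M (Ioo 0 δ))
    (hlip : ∀ t u : ℝ, 0 < t → t ≤ u → u < δ → |M u - M t| ≤ C * Real.log (u / t))
    {n₀ N : ℕ} (hn₀ : 1 ≤ n₀) (hn₀δ : L₀ / δ < n₀) (hN : n₀ ≤ N) :
    |∑ n ∈ Finset.Ico n₀ N, M (L₀ / n) - ∫ y in (n₀:ℝ)..(N:ℝ), M (L₀ / y)| ≤ C * (1 + Real.log N) := by
  -- the integral as a sum of cell integrals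
  have hcells : ∑ n ∈ Finset.Ico n₀ N, (∫ y in (n:ℝ)..(n:ℝ) + 1, M (L₀ / y)) = ∫ y in (n₀:ℝ)..(N:ℝ), M (L₀ / y) := by
    have h := intervalIntegral.sum_integral_adjacent_intervals_Ico (a := fun k : ℕ => (k : ℝ)) (μ := volume)
      (f := fun y => M (L₀ / y)) hN ?_
    · simpa [Nat.cast_add, Nat.cast_one] using h
    · intro k hk
      have hk1 : L₀ / δ < k := lt_of_lt_of_le hn₀δ (by exact_mod_cast hk.1)
      exact ((comp_continuousOn hδ hL₀ hcont).mono fun y hy => by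
        rw [uIcc_of_le (by push_cast; linarith : (k:ℝ) ≤ ((k+1 : ℕ) : ℝ))] at hy; exact lt_of_lt_of_le hk1 hy.1).intervalIntegrable
  rw [← hcells, ← sum_sub_distrib]
  calc _ ≤ ∑ n ∈ Finset.Ico n₀ N, |M (L₀ / n) - ∫ y in (n:ℝ)..(n:ℝ) + 1, M (L₀ / y)| := abs_sum_le_sum_abs _ _
    _ ≤ ∑ n ∈ Finset.Ico n₀ N, C / (n:ℝ) := sum_le_sum fun n hn => by
        obtain ⟨h1, _⟩ := Finset.mem_Ico.mp hn
        exact cell_le hδ hL₀ hC hcont hlip (hn₀.trans h1) (lt_of_lt_of_le hn₀δ (by exact_mod_cast h1))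
    _ = C * ∑ n ∈ Finset.Ico n₀ N, ((n:ℝ))⁻¹ := by rw [mul_sum]; exact sum_congr rfl fun n _ => by rw [div_eq_mul_inv]
    _ ≤ C * (1 + Real.log N) := mul_le_mul_of_nonneg_left (sum_Ico_inv_le' hn₀ hN) hC

/-! ## §2 The substitution s = L₀∕y: the integral is L₀ times row L127's kernel integral -/

/-- **`∫ₐᵇ M(L₀∕y) dy = L₀·∫_{L₀∕b}^{L₀∕a} M(s)∕s² ds`** for `0 < a ≤ b` with `L₀∕a < δ` (row L129's `integral_comp_inv_eq` for `F(s) = M(L₀s)`, then the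
linear substitution `x = L₀s`). [folklore] -/
theorem integral_comp_div_eq (hL₀ : 0 < L₀) (hcont : ContinuousOn M (Ioo 0 δ))
    {a b : ℝ} (ha : 0 < a) (hab : a ≤ b) (haδ : L₀ / a < δ) :
    ∫ y in a..b, M (L₀ / y) = L₀ * ∫ s in (L₀ / b)..(L₀ / a), M s / s ^ 2 := by
  have hb : 0 < b := lt_of_lt_of_le ha hab
  -- F(s) := M(L₀ s) is continuous on [1/b, 1/a]
  have hF : ContinuousOn (fun s => M (L₀ * s)) (Icc b⁻¹ a⁻¹) := by
    refine hcont.comp (continuousOn_const.mul continuousOn_id) fun s hs => ⟨?_, ?_⟩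
    · exact mul_pos hL₀ (lt_of_lt_of_le (inv_pos.mpr hb) hs.1)
    · calc L₀ * s ≤ L₀ * a⁻¹ := mul_le_mul_of_nonneg_left hs.2 hL₀.le
        _ = L₀ / a := by rw [div_eq_mul_inv]
        _ < δ := haδ
  have h1 : ∫ y in a..b, M (L₀ / y) = ∫ y in a..b, (fun s => M (L₀ * s)) y⁻¹ :=
    intervalIntegral.integral_congr fun y _ => by simp [div_eq_mul_inv]
  rw [h1, integral_comp_inv_eq ha hab hF]
  -- ∫_{1/b}^{1/a} M(L₀ s)/s² ds = L₀ ∫_{L₀/b}^{L₀/a} M(x)/x² dx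
  have h2 : (∫ s in b⁻¹..a⁻¹, M (L₀ * s) / s ^ 2) = ∫ s in b⁻¹..a⁻¹, (fun x => L₀ ^ 2 * (M x / x ^ 2)) (L₀ * s) := by
    refine intervalIntegral.integral_congr fun s hs => ?_
    rw [uIcc_of_le ((inv_le_inv₀ hb ha).mpr hab)] at hs
    have hs0 : s ≠ 0 := (lt_of_lt_of_le (inv_pos.mpr hb) hs.1).ne'
    simp only
    field_simp
  rw [h2, intervalIntegral.integral_comp_mul_left (fun x => L₀ ^ 2 * (M x / x ^ 2)) hL₀.ne',
    intervalIntegral.integral_const_mul, smul_eq_mul, show L₀ * b⁻¹ = L₀ / b from (div_eq_mul_inv L₀ b).symm,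
    show L₀ * a⁻¹ = L₀ / a from (div_eq_mul_inv L₀ a).symm]
  have key : ∀ I : ℝ, L₀⁻¹ * (L₀ ^ 2 * I) = L₀ * I := fun I => by field_simp
  rw [key]

/-- **THE CUTOFF SUM IS THE HARMONIC INTEGRAL**: for `1 ≤ n₀ ≤ N` with `L₀∕n₀ < δ`:
**`|Σ_{n₀ ≤ n < N} M(L₀∕n) − L₀·∫_{L₀∕N}^{L₀∕n₀} M(s) s⁻² ds| ≤ C·(1 + log N)`**. [folklore] -/
theorem sum_harmonic_le (hδ : 0 < δ) (hL₀ : 0 < L₀) (hC : 0 ≤ C) (hcont : ContinuousOn M (Ioo 0 δ))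
    (hlip : ∀ t u : ℝ, 0 < t → t ≤ u → u < δ → |M u - M t| ≤ C * Real.log (u / t))
    {n₀ N : ℕ} (hn₀ : 1 ≤ n₀) (hn₀δ : L₀ / n₀ < δ) (hN : n₀ ≤ N) :
    |∑ n ∈ Finset.Ico n₀ N, M (L₀ / n) - L₀ * ∫ s in (L₀ / N)..(L₀ / n₀), M s / s ^ 2| ≤ C * (1 + Real.log N) := by
  have hn₀0 : (0:ℝ) < n₀ := by exact_mod_cast lt_of_lt_of_le Nat.one_pos hn₀
  have hn₀δ' : L₀ / δ < n₀ := by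
    rw [div_lt_iff₀ hδ]; rw [div_lt_iff₀ hn₀0] at hn₀δ; linarith
  rw [← integral_comp_div_eq hL₀ hcont hn₀0 (by exact_mod_cast hN) hn₀δ]
  exact sum_integral_le hδ hL₀ hC hcont hlip hn₀ hn₀δ' hN

/-! ## §3 The boundary estimate -/

/-- `|∫ₐᵇ M(s)∕s² ds| ≤ B·(a⁻¹ − b⁻¹)` for `0 < a ≤ b < δ` and |M| ≤ B on ]0, δ[ (no integrability needed: a non-integrable M has integral 0). [folklore] -/
theorem integral_div_sq_abs_le {B : ℝ} (hB : ∀ s ∈ Ioo 0 δ, |M s| ≤ B)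
    {a b : ℝ} (ha : 0 < a) (hab : a ≤ b) (hbδ : b < δ) :
    |∫ s in a..b, M s / s ^ 2| ≤ B * (a⁻¹ - b⁻¹) := by
  have hB0 : 0 ≤ B := (abs_nonneg _).trans (hB a ⟨ha, lt_of_le_of_lt hab hbδ⟩)
  have hbound : ∀ s ∈ Set.Ioc a b, ‖M s / s ^ 2‖ ≤ B * (s ^ 2)⁻¹ := by
    intro s hs
    have hs0 : 0 < s := lt_of_lt_of_le ha hs.1.le
    rw [Real.norm_eq_abs, abs_div, abs_of_pos (pow_pos hs0 2), div_eq_mul_inv]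
    exact mul_le_mul_of_nonneg_right (hB s ⟨hs0, lt_of_le_of_lt hs.2 hbδ⟩) (by positivity)
  have hint : IntervalIntegrable (fun s : ℝ => B * (s ^ 2)⁻¹) volume a b :=
    ((continuousOn_const.mul ((continuousOn_id.pow 2).inv₀ fun s hs => by
      rw [uIcc_of_le hab] at hs; exact pow_ne_zero 2 (lt_of_lt_of_le ha hs.1).ne'))).intervalIntegrable
  have h := intervalIntegral.norm_integral_le_of_norm_le hab (Filter.Eventually.of_forall fun s => by
    by_cases hs : s ∈ Set.Ioc a b
    · exact fun _ => hbound s hs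
    · exact fun h' => absurd h' hs) hint
  rw [Real.norm_eq_abs, intervalIntegral.integral_const_mul, inv_sq_integral ha hab] at h
  exact h

end

end Summit.QuantumFields.BalabanUV.Beta.EriceFlowEnclosureCesaroClockHarmonic
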